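import Literature.NumberTheory.EllipticCurves.KatoTwistedFinitenessQuadraticTwistProofs
import Literature.NumberTheory.EllipticCurves.QuadraticTwistKroneckerEvenLFunctionProofs
import Literature.NumberTheory.QuadraticFields.KroneckerCharacterFourProofs
import Literature.NumberTheory.QuadraticFields.FundamentalDiscriminant
import HarnessLib

/-!
# Kato's Cor. 14.3 (2) at quadratic characters of even conductor: reduction to the twist over `ℚ`

K. Kato, *`p`-adic Hodge theory and values of zeta functions of modular forms*, Astérisque 295
(2004), Cor. 14.3 (2) (p. 235): for `E/ℚ` modular, `K/ℚ` finite abelian and `χ` a character of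
`Gal(K/ℚ)` with `L(E, χ, 1) ≠ 0`, the `χ`-part `E(K)^(χ)` is finite — vendored for `K = ℚ(ζ_m)`
as the named fact `kato_finite_chiPart_of_twistedLValue_ne_zero` (`KatoTwistedFiniteness.lean`),
with its `K = ℚ`, `χ = 1` case bsd.S20 (`kato_finite_of_L_one_ne_zero`, `PAdicBSD.lean`). The
companion file `KatoTwistedFinitenessQuadraticTwistProofs` carries out Kato's reduction to `K = ℚ`
(14.5–14.7, p. 237) inside the tree's vocabulary for the quadratic characters of ODD squarefree
conductor `m` (`(·/m)`, field `ℚ(√m*)`), where the twisted object `E ⊗ χ` is the elliptic curve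
`E^{(m*)}/ℚ`. This file does the same for the quadratic characters of EVEN conductor: the
Kronecker characters `χ_D = (D/·)` of the even fundamental discriminants `D = 4m`, `m ≡ 2, 3
(mod 4)` squarefree (conductor `|D| = 4|m|`; fields `ℚ(√m)`, among them `ℚ(i)`, `ℚ(√±2)`), and
assembles both parities into one statement indexed by the quadratic fields `K ⊂ ℚ(ζ_M)`.

* §1 — `ζ₄² = −1`, `ζ₈⁴ = −1`, `(ζ₈ + ζ₈⁷)² = 2`, `(ζ₈ + ζ₈³)² = −2`, and for odd `a`:
  `ζ₄^a = (−1/a) ζ₄`, `ζ₈^a + ζ₈^{7a} = (2/a)(ζ₈ + ζ₈⁷)`, `ζ₈^a + ζ₈^{3a} = (−2/a)(ζ₈ + ζ₈³)`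
  (the supplements `(−1/a) = χ₄(a)`, `(±2/a) = χ₈(a), χ₄χ₈(a)`; Ireland–Rosen, Prop. 5.1.3).
* §2 `exists_sqrt_unit_galois` — **`√u ∈ ℚ(ζ_M)` for `u ∈ {−1, 2, −2}`** (`4 ∣ M`, resp.
  `8 ∣ M`) with `σ(√u) = (u/a_σ) √u` for `σ(ζ_M) = ζ_M^{a_σ}`.
* §3 `exists_sqrt_four_mul_galois` — **`√(4m) ∈ ℚ(ζ_M)` for `4|m| ∣ M` with
  `σ(√(4m)) = (m/a_σ) √(4m)`**: `√(4m) = 2 √u √n*` with `n` the odd part of `|m|`,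
  `n* = (−1/n) n ≡ 1 (mod 4)`, `√n* = ∏_{p ∣ n} g_p` the product of Gauss sums of the companion
  file (`exists_sqrt_jacobi_galois_of_dvd`), `u = m/n* ∈ {−1, 2, −2}`, and
  `(m/a) = (u/a)(n*/a) = (u/a)(a/n)` (reciprocity for `n* ≡ 1 (mod 4)`,
  `jacobiSym_natAbs_eq_of_emod_four_eq_one`).
* §4 — the inflated Kronecker character on `Gal(ℚ(ζ_M)/ℚ)` is `σ ↦ (m/a_σ) = ±1`
  (`coe_cyclotomicCharacterOf_changeLevel_of_forall_odd`); some `σ` has `(m/a_σ) = −1` (the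
  character mod `4|m|` is primitive, `isPrimitive_of_forall_odd`, hence non-trivial; lift a unit
  through `(ℤ/M)ˣ → (ℤ/4|m|)ˣ`), so `√(4m) ∉ ℚ`.
* §5 — **`L(E^{(4m)}, s) = L(f, χ_{4m}, s)` is entire** when `E` has good reduction at the primes
  of `4m` (`aₙ(E^{(4m)}) = χ_{4m}(n) aₙ(E)` for ALL `n`, the tree's
  `LFunction_quadraticTwist_apply_of_four_dvd_discr` for the quadratic field of discriminant `4m`,
  `exists_numberField_discr_eq`; `f ⊗ χ ∈ S₂(Γ₀(N (4m)²))` by `charTwist`); hence an entire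
  continuation of `∑ χ(n) aₙ n⁻ˢ` non-vanishing at `1` gives `L(E^{(4m)}, 1) ≠ 0`, and bsd.S20
  makes `E^{(4m)}(ℚ)` finite (`finite_point_quadraticTwist_four_mul_of_twistedLValue_ne_zero`).
* §6 `kato_finite_chiPart_changeLevel_kronecker_of_kato_finite_of_L_one_ne_zero` — **bsd.S20 for
  the twists implies Kato's Cor. 14.3 (2) over `ℚ(ζ_M)` at `χ̃ = changeLevel χ_{4m}`** for every
  `4|m| ∣ M` (`E` good at the primes of `4m`): `E(ℚ(ζ_M))^(χ̃) ↪ E^{(4m)}(ℚ)` through `√(4m)`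
  (the companion file's `finite_chiPart_of_finite_quadraticTwist`).
* §7 `kato_finite_chiPart_changeLevel_kroneckerChar_of_kato_finite_of_L_one_ne_zero` (and the
  least-modulus case `kato_finite_chiPart_kroneckerChar_of_kato_finite_of_L_one_ne_zero`) —
  **both parities**: for every quadratic field `K` with `|d_K| ∣ M` and `E` good at the primes of
  `d_K`, and `κ` its Kronecker character mod `|d_K|` (`κ(n) = (d_K/n)` for odd `n`), the statement
  of `kato_finite_chiPart_of_twistedLValue_ne_zero` at `(M, changeLevel κ)`, from bsd.S20 — by
  the classification of fundamental discriminants (`isFundamentalDiscriminant_discr`), the odd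
  case being the companion file's
  `kato_finite_chiPart_changeLevel_jacobiChar_of_kato_finite_of_L_one_ne_zero`.

Together with `KatoTwistedFinitenessTrivialCharacterProofs` (trivial character) this exhibits the
whole part of Kato's corollary over `ℚ(ζ_M)` that follows from its `K = ℚ` case (equally from
Gross–Zagier–Kolyvagin): all REAL-valued Dirichlet characters whose conductor is prime to the
conductor of `E`. The characters of order `≥ 3` need Kato's Euler system.

Everything here is a theorem; no definition and no named fact is introduced. Kato's theorem
itself is NOT proved here: bsd.S20 enters as the hypothesis `hS20` of §§5–7.

## Scope (what is not covered)

* Real characters with a prime of bad reduction in the conductor (`L(E^{(D)}, s)` and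
  `L(f, χ_D, s)` then differ by finitely many Euler factors, non-vanishing at `s = 1`, but the
  tree's coefficient formula for the twist assumes good reduction at the primes of `D`).
* The dictionary "primitive quadratic Dirichlet characters = Kronecker characters of fundamental
  discriminants" (Montgomery–Vaughan, Thm. 9.13) is not formalised: the statements are indexed by
  quadratic fields / fundamental discriminants, with the character pinned by its values at odd `n`.
* The Selmer-group clause, part (1) of Cor. 14.3.

## References

* K. Kato, *`p`-adic Hodge theory and values of zeta functions of modular forms*, Astérisque 295
  (2004), 117–290: Thm. 14.2, Cor. 14.3 (p. 235), 14.5–14.7 (p. 237). [Kato2004Asterisque]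
* J. H. Silverman, *The Arithmetic of Elliptic Curves*, 2nd ed. (2009), X.2 Prop. 2.4, X.5
  Cor. 5.4, Exercise 10.16. [SilvermanAEC2009]
* K. Ireland, M. Rosen, *A Classical Introduction to Modern Number Theory*, 2nd ed., GTM 84,
  Prop. 5.1.3 (supplements), §5.2 (Jacobi symbol), Prop. 6.3.2 (quadratic Gauss sums).
* D. A. Cox, *Primes of the form x² + ny²*, 2nd ed. (2013), §1.C Lemma 1.14, (1.15)–(1.18).
  [Cox2013]
* H. L. Montgomery, R. C. Vaughan, *Multiplicative Number Theory I* (2007), Thm. 9.13.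
  [MontgomeryVaughan2007]
* G. Shimura, *Introduction to the Arithmetic Theory of Automorphic Functions* (1971), Prop. 3.64.
  [Shimura1971]
-/

noncomputable section

open scoped BigOperators NumberTheorySymbols

open WeierstrassCurve WeierstrassCurve.Affine CongruenceSubgroup Complex

namespace Literature.NumberTheory.EllipticCurves

/-! ## 1. `√−1`, `√2`, `√−2` from primitive `4`-th and `8`-th roots of unity -/

section RootsOfUnity

variable {F : Type*} [Field F]

/-- A primitive `4`-th root of unity `ζ` in a field has `ζ² = −1`. [folklore] -/
theorem sq_eq_neg_one_of_isPrimitiveRoot_four {ζ : F} (hζ : IsPrimitiveRoot ζ 4) : ζ ^ 2 = -1 :=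
  (hζ.pow (by norm_num) (show 4 = 2 * 2 by norm_num)).eq_neg_one_of_two_right

/-- A primitive `8`-th root of unity `ζ` in a field has `ζ⁴ = −1`. [folklore] -/
theorem pow_four_eq_neg_one_of_isPrimitiveRoot_eight {ζ : F} (hζ : IsPrimitiveRoot ζ 8) :
    ζ ^ 4 = -1 :=
  (hζ.pow (by norm_num) (show 8 = 4 * 2 by norm_num)).eq_neg_one_of_two_right

/-- **`√−1 = ζ₄` and its Galois behaviour**: for a primitive `4`-th root of unity `ζ` and odd `a`,
`ζ^a = (−1/a) ζ` (`(−1/a) = χ₄(a)`, Mathlib `jacobiSym.at_neg_one`). [folklore] -/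
theorem pow_eq_jacobiSym_neg_one_mul_of_isPrimitiveRoot_four {ζ : F} (hζ : IsPrimitiveRoot ζ 4)
    {a : ℕ} (ha : Odd a) : ζ ^ a = (J(-1 | a) : F) * ζ := by
  have h2 := sq_eq_neg_one_of_isPrimitiveRoot_four hζ
  have h4 : ζ ^ 4 = 1 := hζ.pow_eq_one
  have hred : ζ ^ a = ζ ^ (a % 4) := by
    conv_lhs => rw [← Nat.mod_add_div a 4, pow_add, pow_mul, h4, one_pow, mul_one]
  rw [jacobiSym.at_neg_one ha, ZMod.χ₄_nat_eq_if_mod_four, hred]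
  have hcases : a % 4 = 1 ∨ a % 4 = 3 := by have := Nat.odd_iff.mp ha; omega
  rcases hcases with h | h
  · simp [h]
    omega
  · have h2' : a % 2 = 1 := Nat.odd_iff.mp ha
    simp only [h2', h, Nat.one_ne_zero, if_false, show (3 : ℕ) ≠ 1 by decide, Int.cast_neg,
      Int.cast_one]
    linear_combination ζ * h2

/-- **`(ζ₈ + ζ₈⁷)² = 2`** for a primitive `8`-th root of unity `ζ₈` (`√2 = ζ₈ + ζ₈⁻¹`). [folklore] -/
theorem sq_zeta_add_zeta_pow_seven_of_isPrimitiveRoot_eight {ζ : F} (hζ : IsPrimitiveRoot ζ 8) :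
    (ζ + ζ ^ 7) ^ 2 = 2 := by
  have h4 := pow_four_eq_neg_one_of_isPrimitiveRoot_eight hζ
  have h8 : ζ ^ 8 = 1 := hζ.pow_eq_one
  linear_combination (2 + ζ ^ 6) * h8 + ζ ^ 2 * h4

/-- **`(ζ₈ + ζ₈³)² = −2`** for a primitive `8`-th root of unity `ζ₈` (`√−2 = ζ₈ + ζ₈³`). [folklore] -/
theorem sq_zeta_add_zeta_pow_three_of_isPrimitiveRoot_eight {ζ : F} (hζ : IsPrimitiveRoot ζ 8) :
    (ζ + ζ ^ 3) ^ 2 = -2 := by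
  have h4 := pow_four_eq_neg_one_of_isPrimitiveRoot_eight hζ
  linear_combination (ζ ^ 2 + 2) * h4

/-- **Galois behaviour of `√2 = ζ₈ + ζ₈⁷`**: for odd `a`, `ζ₈^a + (ζ₈^a)⁷ = (2/a) (ζ₈ + ζ₈⁷)`
(`(2/a) = χ₈(a)`, Mathlib `jacobiSym.at_two`; case analysis on `a mod 8` with `ζ₈⁴ = −1`).
[folklore] -/
theorem zeta_pow_add_pow_seven_of_isPrimitiveRoot_eight {ζ : F} (hζ : IsPrimitiveRoot ζ 8)
    {a : ℕ} (ha : Odd a) : ζ ^ a + (ζ ^ a) ^ 7 = (J(2 | a) : F) * (ζ + ζ ^ 7) := by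
  have h4 := pow_four_eq_neg_one_of_isPrimitiveRoot_eight hζ
  have h8 : ζ ^ 8 = 1 := hζ.pow_eq_one
  have hred : ∀ k : ℕ, ζ ^ k = ζ ^ (k % 8) := fun k => by
    conv_lhs => rw [← Nat.mod_add_div k 8, pow_add, pow_mul, h8, one_pow, mul_one]
  have h2 : a % 2 = 1 := Nat.odd_iff.mp ha
  rw [jacobiSym.at_two ha, ZMod.χ₈_nat_eq_if_mod_eight, ← pow_mul, hred a, hred (a * 7)]
  have hcases : a % 8 = 1 ∨ a % 8 = 3 ∨ a % 8 = 5 ∨ a % 8 = 7 := by omega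
  rcases hcases with h | h | h | h
  · have h7 : a * 7 % 8 = 7 := by omega
    simp only [h, h7, h2]
    norm_num
  · have h7 : a * 7 % 8 = 5 := by omega
    simp only [h, h7, h2]
    norm_num
    linear_combination (ζ + ζ ^ 3) * h4
  · have h7 : a * 7 % 8 = 3 := by omega
    simp only [h, h7, h2]
    norm_num
    linear_combination (ζ + ζ ^ 3) * h4
  · have h7 : a * 7 % 8 = 1 := by omega
    simp only [h, h7, h2]
    norm_num
    ring

/-- **Galois behaviour of `√−2 = ζ₈ + ζ₈³`**: for odd `a`, `ζ₈^a + (ζ₈^a)³ = (−2/a) (ζ₈ + ζ₈³)`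
(`(−2/a) = χ₈'(a)`, Mathlib `jacobiSym.at_neg_two`). [folklore] -/
theorem zeta_pow_add_pow_three_of_isPrimitiveRoot_eight {ζ : F} (hζ : IsPrimitiveRoot ζ 8)
    {a : ℕ} (ha : Odd a) : ζ ^ a + (ζ ^ a) ^ 3 = (J(-2 | a) : F) * (ζ + ζ ^ 3) := by
  have h4 := pow_four_eq_neg_one_of_isPrimitiveRoot_eight hζ
  have h8 : ζ ^ 8 = 1 := hζ.pow_eq_one
  have hred : ∀ k : ℕ, ζ ^ k = ζ ^ (k % 8) := fun k => by
    conv_lhs => rw [← Nat.mod_add_div k 8, pow_add, pow_mul, h8, one_pow, mul_one]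
  have h2 : a % 2 = 1 := Nat.odd_iff.mp ha
  rw [jacobiSym.at_neg_two ha, ZMod.χ₈'_nat_eq_if_mod_eight, ← pow_mul, hred a, hred (a * 3)]
  have hcases : a % 8 = 1 ∨ a % 8 = 3 ∨ a % 8 = 5 ∨ a % 8 = 7 := by omega
  rcases hcases with h | h | h | h
  · have h3 : a * 3 % 8 = 3 := by omega
    simp only [h, h3, h2]
    norm_num
  · have h3 : a * 3 % 8 = 1 := by omega
    simp only [h, h3, h2]
    norm_num
    ring
  · have h3 : a * 3 % 8 = 7 := by omega
    simp only [h, h3, h2]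
    norm_num
    linear_combination (ζ + ζ ^ 3) * h4
  · have h3 : a * 3 % 8 = 5 := by omega
    simp only [h, h3, h2]
    norm_num
    linear_combination (ζ + ζ ^ 3) * h4

end RootsOfUnity

/-! ## 2. `√−1`, `√2`, `√−2` inside `ℚ(ζ_M)` with their Galois action -/

section CyclotomicRoots

open IsCyclotomicExtension Polynomial

variable {M : ℕ} [NeZero M]

set_option backward.isDefEq.respectTransparency false in
/-- For `d ∣ M`, `ζ_M^{M/d}` is a primitive `d`-th root of unity in `ℚ(ζ_M)` (Mathlib
`IsPrimitiveRoot.pow`). [folklore] -/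
theorem isPrimitiveRoot_zeta_pow_div {d : ℕ} (hd : d ∣ M) :
    IsPrimitiveRoot (zeta M ℚ (CyclotomicField M ℚ) ^ (M / d)) d :=
  (zeta_spec M ℚ (CyclotomicField M ℚ)).pow (NeZero.pos M) (Nat.div_mul_cancel hd).symm

set_option backward.isDefEq.respectTransparency false in
/-- `σ ∈ Gal(ℚ(ζ_M)/ℚ)` raises `ζ_M^{M/d}` to the power `a_σ` (`σ(ζ_M) = ζ_M^{a_σ}`,
`algEquiv_zeta_eq_pow`). [folklore] -/
theorem algEquiv_zeta_pow_div (d : ℕ) (σ : CyclotomicField M ℚ ≃ₐ[ℚ] CyclotomicField M ℚ) :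
    σ (zeta M ℚ (CyclotomicField M ℚ) ^ (M / d)) =
      (zeta M ℚ (CyclotomicField M ℚ) ^ (M / d)) ^
        ((autEquivPow (CyclotomicField M ℚ) (cyclotomic.irreducible_rat (NeZero.pos M)) σ :
          (ZMod M)ˣ) : ZMod M).val := by
  rw [map_pow, algEquiv_zeta_eq_pow σ, ← pow_mul, ← pow_mul, mul_comm]

set_option backward.isDefEq.respectTransparency false in
/-- For even `M` the exponent `a_σ ∈ (ℤ/M)ˣ` of `σ ∈ Gal(ℚ(ζ_M)/ℚ)` is odd. [folklore] -/
theorem odd_val_autEquivPow (h2 : 2 ∣ M) (σ : CyclotomicField M ℚ ≃ₐ[ℚ] CyclotomicField M ℚ) :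
    Odd ((autEquivPow (CyclotomicField M ℚ) (cyclotomic.irreducible_rat (NeZero.pos M)) σ :
      (ZMod M)ˣ) : ZMod M).val :=
  Nat.coprime_two_right.mp ((coprime_val_autEquivPow σ).coprime_dvd_right h2)

set_option backward.isDefEq.respectTransparency false in
/-- **`√u ∈ ℚ(ζ_M)` for `u ∈ {−1, 2, −2}`, with Galois action `σ ↦ (u/a_σ)`** (`4 ∣ M` for
`u = −1`, `8 ∣ M` for `u = ±2`): `√−1 = ζ₄ = ζ_M^{M/4}`, `√2 = ζ₈ + ζ₈⁷`, `√−2 = ζ₈ + ζ₈³` with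
`ζ₈ = ζ_M^{M/8}`, and `σ` acts on `ζ_M` by `ζ_M ↦ ζ_M^{a_σ}`, `a_σ` odd, so that
`σ(√u) = (u/a_σ) √u` by the supplements to quadratic reciprocity
(`(−1/a) = χ₄(a)`, `(2/a) = χ₈(a)`, `(−2/a) = χ₄χ₈(a)`; Ireland–Rosen, Prop. 5.1.3 and §6.3;
the quadratic subfields `ℚ(i), ℚ(√2), ℚ(√−2)` of `ℚ(ζ₈)`). [folklore] -/
theorem exists_sqrt_unit_galois {u : ℤ}
    (hu : u = -1 ∧ 4 ∣ M ∨ u = 2 ∧ 8 ∣ M ∨ u = -2 ∧ 8 ∣ M) :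
    ∃ s : CyclotomicField M ℚ, s ^ 2 = (u : CyclotomicField M ℚ) ∧
      ∀ σ : CyclotomicField M ℚ ≃ₐ[ℚ] CyclotomicField M ℚ,
        σ s = (J(u | ((autEquivPow (CyclotomicField M ℚ) (cyclotomic.irreducible_rat (NeZero.pos M))
          σ : (ZMod M)ˣ) : ZMod M).val) : CyclotomicField M ℚ) * s := by
  set ζ := zeta M ℚ (CyclotomicField M ℚ) with hζdef
  rcases hu with ⟨rfl, h4⟩ | ⟨rfl, h8⟩ | ⟨rfl, h8⟩
  · -- `u = -1`: `s = ζ₄`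
    have h2 : 2 ∣ M := dvd_trans (by norm_num) h4
    refine ⟨ζ ^ (M / 4), ?_, fun σ => ?_⟩
    · rw [sq_eq_neg_one_of_isPrimitiveRoot_four (isPrimitiveRoot_zeta_pow_div h4), Int.cast_neg,
        Int.cast_one]
    · rw [hζdef, algEquiv_zeta_pow_div 4 σ]
      exact pow_eq_jacobiSym_neg_one_mul_of_isPrimitiveRoot_four (isPrimitiveRoot_zeta_pow_div h4)
        (odd_val_autEquivPow h2 σ)
  · -- `u = 2`: `s = ζ₈ + ζ₈⁷`
    have h2 : 2 ∣ M := dvd_trans (by norm_num) h8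
    refine ⟨ζ ^ (M / 8) + (ζ ^ (M / 8)) ^ 7, ?_, fun σ => ?_⟩
    · rw [sq_zeta_add_zeta_pow_seven_of_isPrimitiveRoot_eight (isPrimitiveRoot_zeta_pow_div h8),
        Int.cast_two]
    · rw [map_add, map_pow σ _ 7, hζdef, algEquiv_zeta_pow_div 8 σ]
      exact zeta_pow_add_pow_seven_of_isPrimitiveRoot_eight (isPrimitiveRoot_zeta_pow_div h8)
        (odd_val_autEquivPow h2 σ)
  · -- `u = -2`: `s = ζ₈ + ζ₈³`
    have h2 : 2 ∣ M := dvd_trans (by norm_num) h8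
    refine ⟨ζ ^ (M / 8) + (ζ ^ (M / 8)) ^ 3, ?_, fun σ => ?_⟩
    · rw [sq_zeta_add_zeta_pow_three_of_isPrimitiveRoot_eight (isPrimitiveRoot_zeta_pow_div h8),
        Int.cast_neg, Int.cast_two]
    · rw [map_add, map_pow σ _ 3, hζdef, algEquiv_zeta_pow_div 8 σ]
      exact zeta_pow_add_pow_three_of_isPrimitiveRoot_eight (isPrimitiveRoot_zeta_pow_div h8)
        (odd_val_autEquivPow h2 σ)

end CyclotomicRoots

/-! ## 3. `√(4m) ∈ ℚ(ζ_M)` for an even fundamental discriminant `4m ∣ M`, with Galois action `(m/·)` -/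

section SqrtFourMul

open IsCyclotomicExtension Polynomial QuadraticFields

variable {M : ℕ} [NeZero M]

/-- `(−1/n) = ±1` for every `n`. [folklore] -/
theorem jacobiSym_neg_one_eq_one_or (n : ℕ) [NeZero n] : J(-1 | n) = 1 ∨ J(-1 | n) = -1 := by
  have h0 : J(-1 | n) ≠ 0 := by
    rw [Ne, jacobiSym.eq_zero_iff_not_coprime, not_not]
    simp
  rcases jacobiSym.trichotomy (-1) n with h | h | h
  · exact (h0 h).elim
  · exact Or.inl h
  · exact Or.inr h

set_option backward.isDefEq.respectTransparency false in
/-- **Assembly `√(4m) = 2 · √u · √n*`.** Let `n ∣ M` be odd and squarefree, `n* = (−1/n) n`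
(`≡ 1 (mod 4)`), `u ∈ {−1, 2, −2}` with `4 ∣ M`, resp. `8 ∣ M`, and `m = u · n*`. Then
`θ = 2 √u √n* ∈ ℚ(ζ_M)` (`√n*` the product of Gauss sums of `exists_sqrt_jacobi_galois_of_dvd`,
`√u` from `exists_sqrt_unit_galois`) has `θ² = 4m` and `σ(θ) = (m/a_σ) θ`, because
`(m/a) = (u/a) (n*/a)` and `(n*/a) = (a/n)` for odd `a` (reciprocity for `n* ≡ 1 (mod 4)`,
the tree's `jacobiSym_natAbs_eq_of_emod_four_eq_one`). [folklore] -/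
theorem exists_sqrt_four_mul_galois_of_eq {m u : ℤ} {n : ℕ} [NeZero n] (hn : n ∣ M) (hodd : Odd n)
    (hsq : Squarefree n) (hu : u = -1 ∧ 4 ∣ M ∨ u = 2 ∧ 8 ∣ M ∨ u = -2 ∧ 8 ∣ M)
    (hm : m = u * (J(-1 | n) * n)) :
    ∃ θ : CyclotomicField M ℚ, θ ^ 2 = ((4 * m : ℤ) : CyclotomicField M ℚ) ∧
      ∀ σ : CyclotomicField M ℚ ≃ₐ[ℚ] CyclotomicField M ℚ,
        σ θ = (J(m | ((autEquivPow (CyclotomicField M ℚ) (cyclotomic.irreducible_rat (NeZero.pos M))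
          σ : (ZMod M)ˣ) : ZMod M).val) : CyclotomicField M ℚ) * θ := by
  subst hm
  have h2 : 2 ∣ M := by
    rcases hu with ⟨-, h⟩ | ⟨-, h⟩ | ⟨-, h⟩
    · exact dvd_trans (by norm_num) h
    · exact dvd_trans (by norm_num) h
    · exact dvd_trans (by norm_num) h
  obtain ⟨hD4, hDabs⟩ := jacobiSym_neg_one_mul_self (m := n) hodd
  obtain ⟨θ₀, hθ₀, -, hθ₀σ⟩ := exists_sqrt_jacobi_galois_of_dvd hn hodd hsq
  obtain ⟨s, hs, hsσ⟩ := exists_sqrt_unit_galois (M := M) hu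
  refine ⟨2 * s * θ₀, ?_, fun σ => ?_⟩
  · rw [mul_pow, mul_pow, hs, hθ₀]
    push_cast
    ring
  · set a : ℕ := ((autEquivPow (CyclotomicField M ℚ) (cyclotomic.irreducible_rat (NeZero.pos M)) σ :
      (ZMod M)ˣ) : ZMod M).val with ha
    have haodd : Odd a := odd_val_autEquivPow h2 σ
    rw [map_mul, map_mul, map_ofNat, hsσ σ, hθ₀σ σ, jacobiSym.mul_left,
      ← jacobiSym_natAbs_eq_of_emod_four_eq_one hD4 haodd, hDabs]
    push_cast
    ring

set_option backward.isDefEq.respectTransparency false in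
/-- **`√(4m) ∈ ℚ(ζ_M)` for `m ≡ 2, 3 (mod 4)` squarefree with `4|m| ∣ M`, with Galois action
`σ ↦ (m/a_σ)`** — the element generating the quadratic subfield `ℚ(√m)` of `ℚ(ζ_{4|m|}) ⊂ ℚ(ζ_M)`
(conductor–discriminant formula for the even fundamental discriminant `D = 4m`; Washington,
*Cyclotomic Fields*, Ch. 3; Cox, §1.C (1.15)–(1.18)). Cases: `m ≡ 3 (mod 4)`: `m = −n*` with
`n = |m|`, `θ = 2 ζ₄ √n*`; `m = 2m'` with `m'` odd: `m' = ±n*` with `n = |m'|`,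
`θ = 2 √(±2) √n*`. [folklore] -/
theorem exists_sqrt_four_mul_galois {m : ℤ} (hm4 : m % 4 = 2 ∨ m % 4 = 3) (hsq : Squarefree m)
    (hd : 4 * m.natAbs ∣ M) :
    ∃ θ : CyclotomicField M ℚ, θ ^ 2 = ((4 * m : ℤ) : CyclotomicField M ℚ) ∧
      ∀ σ : CyclotomicField M ℚ ≃ₐ[ℚ] CyclotomicField M ℚ,
        σ θ = (J(m | ((autEquivPow (CyclotomicField M ℚ) (cyclotomic.irreducible_rat (NeZero.pos M))
          σ : (ZMod M)ˣ) : ZMod M).val) : CyclotomicField M ℚ) * θ := by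
  rcases hm4 with hm2 | hm3
  · -- `m = 2 m'`, `m'` odd
    obtain ⟨m', rfl⟩ : (2 : ℤ) ∣ m := by omega
    have hm'odd : Odd m' := Int.odd_iff.mpr (by omega)
    set n : ℕ := m'.natAbs with hn
    have hn0 : n ≠ 0 := by
      rw [hn, Ne, Int.natAbs_eq_zero]
      rintro rfl
      omega
    haveI : NeZero n := ⟨hn0⟩
    have hnodd : Odd n := Int.natAbs_odd.mpr hm'odd
    have hnsq : Squarefree n :=
      Int.squarefree_natAbs.mpr (Squarefree.squarefree_of_dvd (dvd_mul_left m' 2) hsq)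
    have habs : (2 * m').natAbs = 2 * n := by rw [Int.natAbs_mul, hn]; rfl
    have h8 : 8 ∣ M := dvd_trans ⟨n, by rw [habs]; ring⟩ hd
    have hnM : n ∣ M := dvd_trans ⟨8, by rw [habs]; ring⟩ hd
    have key : m' = J(-1 | n) * n ∨ m' = -(J(-1 | n) * n) := by
      rcases Int.natAbs_eq m' with h | h <;> rcases jacobiSym_neg_one_eq_one_or n with hJ | hJ <;>
        rw [hJ] <;> omega
    rcases key with hk | hk
    · exact exists_sqrt_four_mul_galois_of_eq (m := 2 * m') (u := 2) hnM hnodd hnsq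
        (Or.inr (Or.inl ⟨rfl, h8⟩)) (by rw [← hk])
    · exact exists_sqrt_four_mul_galois_of_eq (m := 2 * m') (u := -2) hnM hnodd hnsq
        (Or.inr (Or.inr ⟨rfl, h8⟩)) (by rw [hk]; ring)
  · -- `m` odd, `m ≡ 3 (mod 4)`: `m = -n*`
    set n : ℕ := m.natAbs with hn
    have hmodd : Odd m := Int.odd_iff.mpr (by omega)
    have hn0 : n ≠ 0 := by
      rw [hn, Ne, Int.natAbs_eq_zero]
      rintro rfl
      omega
    haveI : NeZero n := ⟨hn0⟩
    have hnodd : Odd n := Int.natAbs_odd.mpr hmodd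
    have hnsq : Squarefree n := Int.squarefree_natAbs.mpr hsq
    have h4 : 4 ∣ M := dvd_trans (dvd_mul_right 4 n) hd
    have hnM : n ∣ M := dvd_trans (dvd_mul_left n 4) hd
    have key : m = -(J(-1 | n) * n) := by
      obtain ⟨hD4, -⟩ := jacobiSym_neg_one_mul_self (m := n) hnodd
      rcases Int.natAbs_eq m with h | h <;> rcases jacobiSym_neg_one_eq_one_or n with hJ | hJ <;>
        rw [hJ] at hD4 ⊢ <;> omega
    exact exists_sqrt_four_mul_galois_of_eq (m := m) (u := -1) hnM hnodd hnsq (Or.inl ⟨rfl, h4⟩)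
      (by rw [key]; ring)

end SqrtFourMul

/-! ## 4. The Kronecker character `(m/·)` on `Gal(ℚ(ζ_M)/ℚ)` -/

section KroneckerGalois

open IsCyclotomicExtension Polynomial QuadraticFields

variable {M : ℕ} [NeZero M] {m : ℤ}

set_option backward.isDefEq.respectTransparency false in
/-- `(m/a_σ) = ±1` for `σ ∈ Gal(ℚ(ζ_M)/ℚ)` when `|m| ∣ M` (`a_σ` is prime to `M`, hence to `m`).
[folklore] -/
theorem jacobiSym_autEquivPow_eq_one_or_of_natAbs_dvd (hd : m.natAbs ∣ M)
    (σ : CyclotomicField M ℚ ≃ₐ[ℚ] CyclotomicField M ℚ) :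
    J(m | ((autEquivPow (CyclotomicField M ℚ) (cyclotomic.irreducible_rat (NeZero.pos M)) σ :
        (ZMod M)ˣ) : ZMod M).val) = 1 ∨
    J(m | ((autEquivPow (CyclotomicField M ℚ) (cyclotomic.irreducible_rat (NeZero.pos M)) σ :
        (ZMod M)ˣ) : ZMod M).val) = -1 := by
  set a : ℕ := ((autEquivPow (CyclotomicField M ℚ) (cyclotomic.irreducible_rat (NeZero.pos M)) σ :
    (ZMod M)ˣ) : ZMod M).val with ha
  by_cases ha0 : a = 0
  · exact Or.inl (by rw [ha0, jacobiSym.zero_right])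
  haveI : NeZero a := ⟨ha0⟩
  have h0 : J(m | a) ≠ 0 := by
    rw [Ne, jacobiSym.eq_zero_iff_not_coprime, not_not, Int.gcd_eq_natAbs, Int.natAbs_natCast]
    exact ((coprime_val_autEquivPow σ).coprime_dvd_right hd).symm
  rcases jacobiSym.trichotomy m a with h | h | h
  · exact (h0 h).elim
  · exact Or.inl h
  · exact Or.inr h


set_option backward.isDefEq.respectTransparency false in
/-- **The inflated Kronecker character on `Gal(ℚ(ζ_M)/ℚ)` is `σ ↦ (m/a_σ)`.** For a Dirichlet
character `χ` mod `q = 4|m|` with `χ(n) = (m/n)` for odd `n` (the Kronecker character of the even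
discriminant `4m`, `exists_dirichletCharacter_four_mul`) and `q ∣ M`, the character of
`Gal(ℚ(ζ_M)/ℚ)` attached to `changeLevel χ` (mod `M`) takes the value `(m/a_σ)` at `σ`
(`a_σ` is odd as `M` is even). [folklore] -/
theorem coe_cyclotomicCharacterOf_changeLevel_of_forall_odd {q : ℕ} (hq : q = 4 * m.natAbs)
    (hd : q ∣ M) {χ : DirichletCharacter ℂ q} (hχ : ∀ n : ℕ, Odd n → χ n = (J(m | n) : ℂ))
    (σ : CyclotomicField M ℚ ≃ₐ[ℚ] CyclotomicField M ℚ) :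
    (cyclotomicCharacterOf (DirichletCharacter.changeLevel hd χ) σ : ℂ) =
      (J(m | ((autEquivPow (CyclotomicField M ℚ) (cyclotomic.irreducible_rat (NeZero.pos M)) σ :
        (ZMod M)ˣ) : ZMod M).val) : ℂ) := by
  have h2 : 2 ∣ M := dvd_trans ⟨2 * m.natAbs, by rw [hq]; ring⟩ hd
  rw [coe_cyclotomicCharacterOf_apply, DirichletCharacter.changeLevel_eq_cast_of_dvd χ hd,
    ZMod.cast_eq_val, hχ _ (odd_val_autEquivPow h2 σ)]

/-- For `m ≡ 2, 3 (mod 4)` squarefree, a unit `u` mod `4|m|` has `(m/u) = ±1`, and some unit has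
`(m/u) = −1`: the Kronecker character mod `4|m|` is primitive of conductor `4|m| > 1`
(`isPrimitive_of_forall_odd`), hence non-trivial. [folklore] -/
theorem exists_unit_jacobiSym_eq_neg_one (hm4 : m % 4 = 2 ∨ m % 4 = 3) (hsq : Squarefree m) :
    ∃ u : (ZMod (4 * m.natAbs))ˣ, J(m | (u : ZMod (4 * m.natAbs)).val) = -1 := by
  have hm0 : m ≠ 0 := hsq.ne_zero
  haveI : NeZero (4 * m.natAbs) := ⟨mul_ne_zero (by norm_num) (Int.natAbs_ne_zero.mpr hm0)⟩
  obtain ⟨χ, hχ⟩ := exists_dirichletCharacter_four_mul m hm0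
  have hprim : χ.IsPrimitive := isPrimitive_of_forall_odd hm4 hsq hχ
  have hne : χ ≠ 1 := by
    intro h
    have hc : χ.conductor = 4 * m.natAbs := hprim
    rw [h, DirichletCharacter.conductor_one] at hc
    have := Int.natAbs_pos.mpr hm0
    omega
  obtain ⟨u, hu⟩ := MulChar.ne_one_iff.mp hne
  refine ⟨u, ?_⟩
  have huodd : Odd (u : ZMod (4 * m.natAbs)).val :=
    Nat.coprime_two_right.mp ((ZMod.val_coe_unit_coprime u).coprime_dvd_right ⟨2 * m.natAbs, by ring⟩)
  have hval : χ u = (J(m | (u : ZMod (4 * m.natAbs)).val) : ℂ) := by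
    rw [← hχ _ huodd, ZMod.natCast_zmod_val]
  have h1 : J(m | (u : ZMod (4 * m.natAbs)).val) ≠ 1 := fun h =>
    hu (by rw [hval, h, Int.cast_one])
  haveI : NeZero (u : ZMod (4 * m.natAbs)).val :=
    ⟨fun h0 => by have := Nat.odd_iff.mp huodd; omega⟩
  have h0 : J(m | (u : ZMod (4 * m.natAbs)).val) ≠ 0 := by
    rw [Ne, jacobiSym.eq_zero_iff_not_coprime, not_not, Int.gcd_eq_natAbs, Int.natAbs_natCast]
    exact ((ZMod.val_coe_unit_coprime u).coprime_dvd_right (dvd_mul_left _ 4)).symm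
  rcases jacobiSym.trichotomy m (u : ZMod (4 * m.natAbs)).val with h | h | h
  · exact (h0 h).elim
  · exact (h1 h).elim
  · exact h

set_option backward.isDefEq.respectTransparency false in
/-- For `m ≡ 2, 3 (mod 4)` squarefree with `4|m| ∣ M`, some `σ ∈ Gal(ℚ(ζ_M)/ℚ)` has
`(m/a_σ) = −1`: lift a unit `u` mod `4|m|` with `(m/u) = −1` to `(ℤ/M)ˣ`
(Mathlib `ZMod.unitsMap_surjective`) and take `σ = autEquivPow⁻¹(u)`; the symbol only depends on
`a_σ mod 4|m|` for odd `a_σ` (Mathlib `jacobiSym.mod_right`). [folklore] -/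
theorem exists_algEquiv_kronecker_eq_neg_one (hm4 : m % 4 = 2 ∨ m % 4 = 3) (hsq : Squarefree m)
    (hd : 4 * m.natAbs ∣ M) :
    ∃ σ : CyclotomicField M ℚ ≃ₐ[ℚ] CyclotomicField M ℚ,
      J(m | ((autEquivPow (CyclotomicField M ℚ) (cyclotomic.irreducible_rat (NeZero.pos M)) σ :
        (ZMod M)ˣ) : ZMod M).val) = -1 := by
  have hm0 : m ≠ 0 := hsq.ne_zero
  haveI : NeZero (4 * m.natAbs) := ⟨mul_ne_zero (by norm_num) (Int.natAbs_ne_zero.mpr hm0)⟩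
  have h2 : 2 ∣ M := dvd_trans ⟨2 * m.natAbs, by ring⟩ hd
  obtain ⟨u, hu⟩ := exists_unit_jacobiSym_eq_neg_one hm4 hsq
  obtain ⟨U, hU⟩ := ZMod.unitsMap_surjective hd u
  refine ⟨(autEquivPow (CyclotomicField M ℚ) (cyclotomic.irreducible_rat (NeZero.pos M))).symm U, ?_⟩
  rw [MulEquiv.apply_symm_apply]
  have huodd : Odd (u : ZMod (4 * m.natAbs)).val :=
    Nat.coprime_two_right.mp ((ZMod.val_coe_unit_coprime u).coprime_dvd_right ⟨2 * m.natAbs, by ring⟩)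
  have hUodd : Odd (U : ZMod M).val :=
    Nat.coprime_two_right.mp ((ZMod.val_coe_unit_coprime U).coprime_dvd_right h2)
  have hval : (u : ZMod (4 * m.natAbs)).val = (U : ZMod M).val % (4 * m.natAbs) := by
    rw [← hU, ZMod.unitsMap_val, ZMod.cast_eq_val, ZMod.val_natCast]
  rw [jacobiSym.mod_right m hUodd, ← hu, jacobiSym.mod_right m huodd, hval, Nat.mod_mod]

set_option backward.isDefEq.respectTransparency false in
/-- An element `θ ≠ 0` of `ℚ(ζ_M)` on which `Gal(ℚ(ζ_M)/ℚ)` acts through `(m/a_σ)`, `m ≡ 2, 3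
(mod 4)` squarefree with `4|m| ∣ M`, is irrational: some `σ` negates it. [folklore] -/
theorem not_mem_range_of_kronecker_galois (hm4 : m % 4 = 2 ∨ m % 4 = 3) (hsq : Squarefree m)
    (hd : 4 * m.natAbs ∣ M) {θ : CyclotomicField M ℚ} (hθ0 : θ ≠ 0)
    (hθσ : ∀ σ : CyclotomicField M ℚ ≃ₐ[ℚ] CyclotomicField M ℚ,
      σ θ = (J(m | ((autEquivPow (CyclotomicField M ℚ) (cyclotomic.irreducible_rat (NeZero.pos M))
        σ : (ZMod M)ˣ) : ZMod M).val) : CyclotomicField M ℚ) * θ) :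
    θ ∉ Set.range (algebraMap ℚ (CyclotomicField M ℚ)) := by
  obtain ⟨σ, hσ⟩ := exists_algEquiv_kronecker_eq_neg_one hm4 hsq hd
  rintro ⟨q, hq⟩
  have h := hθσ σ
  rw [hσ, ← hq, AlgEquiv.commutes, Int.cast_neg, Int.cast_one, neg_one_mul] at h
  exact hθ0 (hq ▸ CharZero.eq_neg_self_iff.mp h)

end KroneckerGalois

/-! ## 5. `L(E^{(4m)}, s) = L(f, χ_{4m}, s)` is entire; `L(f, χ_{4m}, 1) ≠ 0 ⇒ E^{(4m)}(ℚ)` finite -/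

section LSide

open ModularForms QuadraticFields QuadraticFields.Quadratic IsDedekindDomain NumberField
  Rat.HeightOneSpectrum

variable {N : ℕ} [NeZero N]

/-- **`L(W', s)` is entire when `aₙ(W') = χ(n) aₙ(f)`** for `f ∈ S₂(Γ₀(N))` and a primitive
quadratic Dirichlet character `χ` mod `q`: the coefficients are those of the twist
`f ⊗ χ ∈ S₂(Γ₀(N q²))` (the tree's `charTwist`, `cuspCoeff_charTwist`; Shimura 1971, Prop. 3.64),
and the `L`-series of a weight-`2` cusp form is entire (`hasEntireLFunction_of_cuspCoeff_eq`,
Hecke). (The odd-squarefree-conductor case is `hasEntireLFunction_of_coeff_jacobiChar`.)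
[cite: Shimura1971, Prop. 3.64] -/
theorem hasEntireLFunction_of_coeff_of_isPrimitive (W' : WeierstrassCurve ℚ)
    (f : CuspForm (Gamma0 N) 2) {q : ℕ} [NeZero q] {χ : DirichletCharacter ℂ q}
    (hχq : χ.IsQuadratic) (hprim : χ.IsPrimitive)
    (hco : ∀ n : ℕ, ((W'.LFunction n : ℤ) : ℂ) = χ n * cuspCoeff f n) :
    W'.HasEntireLFunction := by
  have hN : N ∣ N * q ^ 2 := dvd_mul_right N _
  have hm : q ^ 2 ∣ N * q ^ 2 := dvd_mul_left _ _
  haveI : NeZero (N * q ^ 2) := ⟨mul_ne_zero (NeZero.ne N) (pow_ne_zero 2 (NeZero.ne q))⟩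
  exact W'.hasEntireLFunction_of_cuspCoeff_eq (strictWidthInfty_Gamma0 (N * q ^ 2))
    (charTwist (N * q ^ 2) hN hm hχq f) fun n => by
      rw [cuspCoeff_charTwist (N * q ^ 2) hN hm hχq hprim f n, hco n]

/-- `J(4 | n) = 1` for odd `n`. [folklore] -/
theorem jacobiSym_four_of_odd {n : ℕ} (hn : Odd n) : J(4 | n) = 1 := by
  rw [show (4 : ℤ) = 2 ^ 2 by norm_num]
  exact jacobiSym.sq_one' (by
    rw [Int.gcd_eq_natAbs]
    exact Nat.coprime_two_left.mpr hn)

/-- **`aₙ(E^{(4m)}) = (m/n) aₙ(E)` for odd `n`, `0` for even `n`**, for `m ≡ 2, 3 (mod 4)`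
squarefree and `E` with good reduction at the primes dividing `4m`: the tree's
`LFunction_quadraticTwist_apply_of_four_dvd_discr` for the quadratic field of discriminant `4m`
(`exists_numberField_discr_eq`). [cite: SilvermanAEC2009, X.2 and Exercise 10.16] -/
theorem LFunction_quadraticTwist_four_mul_apply (W : WeierstrassCurve ℚ) [W.IsElliptic] {m : ℤ}
    (hm4 : m % 4 = 2 ∨ m % 4 = 3) (hsq : Squarefree m)
    (hgood : ∀ v : HeightOneSpectrum (𝓞 ℚ), ((primesEquiv v : ℕ) : ℤ) ∣ 4 * m →
      W.HasGoodReductionAt v)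
    (n : ℕ) :
    (W.quadraticTwist ((4 * m : ℤ) : ℚ)).LFunction n =
      (if Even n then 0 else J(m | n)) * W.LFunction n := by
  have hdiv : (4 * m : ℤ) / 4 = m := Int.mul_ediv_cancel_left _ four_ne_zero
  obtain ⟨K, _, _, h2, hK⟩ := exists_numberField_discr_eq (D := 4 * m)
    (Or.inr ⟨dvd_mul_right 4 m, by rw [hdiv]; exact hm4, by rw [hdiv]; exact hsq⟩)
  have h4 : 4 ∣ NumberField.discr K := by rw [hK]; exact dvd_mul_right 4 m
  have hgood' : ∀ v : HeightOneSpectrum (𝓞 ℚ), ((primesEquiv v : ℕ) : ℤ) ∣ NumberField.discr K →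
      W.HasGoodReductionAt v := fun v hv => hgood v (by rwa [hK] at hv)
  have h := W.LFunction_quadraticTwist_apply_of_four_dvd_discr K h2 h4 hgood' n
  rw [hK, hdiv] at h
  exact h

set_option backward.isDefEq.respectTransparency false in
/-- **`L(f, χ_{4m}, 1) ≠ 0 ⇒ E^{(4m)}(ℚ)` finite, given bsd.S20.** For `E/ℚ` elliptic with newform
`f`, `m ≡ 2, 3 (mod 4)` squarefree with `E` good at the primes of `4m`, `χ` the Kronecker
character mod `q = 4|m|` (`χ(n) = (m/n)` for odd `n`), and an entire continuation of
`∑ χ(n) aₙ n⁻ˢ` non-vanishing at `1`: `aₙ(E^{(4m)}) = χ(n) aₙ(E)` for all `n`, so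
`L(E^{(4m)}, s) = L(f, χ, s)` is entire (`f ⊗ χ ∈ S₂(Γ₀(N q²))`, `χ` primitive quadratic by
`isPrimitive_of_forall_odd`) and `L(E^{(4m)}, 1) ≠ 0` (identity theorem); then
`kato_finite_of_L_one_ne_zero` for `E^{(4m)}` (at `p = 2`) makes `E^{(4m)}(ℚ)` finite.
[cite: Kato2004Asterisque, Cor. 14.3 (2) (p. 235)] -/
theorem finite_point_quadraticTwist_four_mul_of_twistedLValue_ne_zero
    (hS20 : ∀ (V : WeierstrassCurve ℚ) [V.IsElliptic] (p : ℕ) [Fact p.Prime],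
      kato_finite_of_L_one_ne_zero V p)
    (W : WeierstrassCurve ℚ) [W.IsElliptic] {f : CuspForm (Gamma0 N) 2} (hf : IsNewformOf W f)
    {m : ℤ} (hm4 : m % 4 = 2 ∨ m % 4 = 3) (hsq : Squarefree m) {q : ℕ} [NeZero q]
    (hq : q = 4 * m.natAbs) {χ : DirichletCharacter ℂ q}
    (hχ : ∀ n : ℕ, Odd n → χ n = (J(m | n) : ℂ))
    (hgood : ∀ v : HeightOneSpectrum (𝓞 ℚ), ((primesEquiv v : ℕ) : ℤ) ∣ 4 * m →
      W.HasGoodReductionAt v)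
    (hL : ∃ L : ℂ → ℂ, Differentiable ℂ L ∧
      (∀ s : ℂ, 2 < s.re → L s = twistedLSeries f χ s) ∧ L 1 ≠ 0) :
    Finite (W.quadraticTwist ((4 * m : ℤ) : ℚ)).toAffine.Point := by
  subst hq
  have hm0 : m ≠ 0 := hsq.ne_zero
  have hD0 : ((4 * m : ℤ) : ℚ) ≠ 0 := by exact_mod_cast mul_ne_zero four_ne_zero hm0
  haveI : (W.quadraticTwist ((4 * m : ℤ) : ℚ)).IsElliptic := W.isElliptic_quadraticTwist hD0
  have hco : ∀ n : ℕ, (((W.quadraticTwist ((4 * m : ℤ) : ℚ)).LFunction n : ℤ) : ℂ) =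
      χ n * cuspCoeff f n := fun n => by
    rw [LFunction_quadraticTwist_four_mul_apply W hm4 hsq hgood n, Int.cast_mul, hf.2 n]
    congr 1
    by_cases hn : Even n
    · rw [if_pos hn, Int.cast_zero, apply_eq_zero_of_even (χ := χ)]
      rw [ZMod.val_natCast, Nat.even_iff, Nat.mod_mod_of_dvd n ⟨2 * m.natAbs, by ring⟩]
      exact Nat.even_iff.mp hn
    · rw [if_neg hn, hχ n (Nat.not_even_iff_odd.mp hn)]
  have hE := hasEntireLFunction_of_coeff_of_isPrimitive _ f (isQuadratic_of_forall_odd hm0 hχ)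
    (isPrimitive_of_forall_odd hm4 hsq hχ) hco
  have h1 := entireLFunction_one_ne_zero_of_twistedLSeries _ hE f χ hco hL
  haveI : Fact (Nat.Prime 2) := ⟨Nat.prime_two⟩
  exact (hS20 _ 2 h1).1

end LSide

/-! ## 6. Kato's Cor. 14.3 (2) over `ℚ(ζ_M)` at the even-conductor quadratic characters -/

section Assembly

open ModularForms QuadraticFields QuadraticFields.Quadratic IsCyclotomicExtension Polynomial
  IsDedekindDomain NumberField Rat.HeightOneSpectrum

variable {M : ℕ} [NeZero M]

set_option backward.isDefEq.respectTransparency false in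
/-- **Kato's Cor. 14.3 (2) over `ℚ(ζ_M)` at every quadratic character of even conductor, from
bsd.S20 for the twist.** Assume `kato_finite_of_L_one_ne_zero V p` (bsd.S20: `L(V, 1) ≠ 0 ⇒ V(ℚ)`
finite; Kato Cor. 14.3 with `K = ℚ`, `χ = 1`, equally a consequence of Gross–Zagier–Kolyvagin)
for every elliptic `V/ℚ` and prime `p`. Let `E/ℚ` be elliptic with newform `f`, `m ≡ 2, 3
(mod 4)` squarefree (so `D = 4m` is an even fundamental discriminant) with `E` of good reduction
at the primes dividing `4m`, `q = 4|m| ∣ M`, `χ` the Kronecker character mod `q`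
(`χ(n) = (m/n)` for odd `n`; primitive of conductor `q`), and `χ̃ = changeLevel χ` mod `M`. If
the mod-`M` series `∑ χ̃(n) aₙ n⁻ˢ` has an entire continuation non-vanishing at `1`, then
`E(ℚ(ζ_M))^(χ̃)` is finite: the mod-`q` series inherits the hypothesis
(`exists_continuation_of_changeLevel`), `E^{(4m)}(ℚ)` is finite
(`finite_point_quadraticTwist_four_mul_of_twistedLValue_ne_zero`), and
`E(ℚ(ζ_M))^(χ̃) ↪ E^{(4m)}(ℚ)` through `√(4m) ∈ ℚ(ζ_M)` (`exists_sqrt_four_mul_galois`,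
`finite_chiPart_of_finite_quadraticTwist`), the character being `σ ↦ (m/a_σ)`
(`coe_cyclotomicCharacterOf_changeLevel_of_forall_odd`). This is Kato's reduction 14.6 of
Thm. 14.2 to `K = ℚ` in the case where the twisted object `E ⊗ χ` is the elliptic curve
`E^{(4m)}/ℚ`. [cite: Kato2004Asterisque, Cor. 14.3 (2) (p. 235)] -/
theorem kato_finite_chiPart_changeLevel_kronecker_of_kato_finite_of_L_one_ne_zero
    (hS20 : ∀ (V : WeierstrassCurve ℚ) [V.IsElliptic] (p : ℕ) [Fact p.Prime],
      kato_finite_of_L_one_ne_zero V p)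
    (W : WeierstrassCurve ℚ) [W.IsElliptic] {N : ℕ} [NeZero N] {f : CuspForm (Gamma0 N) 2}
    (hf : IsNewformOf W f) [DecidableEq (CyclotomicField M ℚ)] {m : ℤ}
    (hm4 : m % 4 = 2 ∨ m % 4 = 3) (hsq : Squarefree m) {q : ℕ} [NeZero q] (hq : q = 4 * m.natAbs)
    (hd : q ∣ M) {χ : DirichletCharacter ℂ q} (hχ : ∀ n : ℕ, Odd n → χ n = (J(m | n) : ℂ))
    (hgood : ∀ v : HeightOneSpectrum (𝓞 ℚ), ((primesEquiv v : ℕ) : ℤ) ∣ 4 * m →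
      W.HasGoodReductionAt v)
    (hL : ∃ L : ℂ → ℂ, Differentiable ℂ L ∧
      (∀ s : ℂ, 2 < s.re →
        L s = twistedLSeries f (DirichletCharacter.changeLevel hd χ) s) ∧ L 1 ≠ 0) :
    Finite (chiPart
      (fun σ : CyclotomicField M ℚ ≃ₐ[ℚ] CyclotomicField M ℚ =>
        Point.map (W' := W.toAffine) (σ : CyclotomicField M ℚ →ₐ[ℚ] CyclotomicField M ℚ))
      (fun σ => (cyclotomicCharacterOf (DirichletCharacter.changeLevel hd χ) σ : ℂ))) := by
  -- finiteness of `E^{(4m)}(ℚ)` from the mod-`q` hypothesis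
  have hfin := finite_point_quadraticTwist_four_mul_of_twistedLValue_ne_zero hS20 W hf hm4 hsq hq hχ
    hgood (exists_continuation_of_changeLevel hf.1 hd χ hL)
  -- `√(4m) ∈ ℚ(ζ_M)`
  have hd' : 4 * m.natAbs ∣ M := hq ▸ hd
  obtain ⟨θ, hθ2, hθσ⟩ := exists_sqrt_four_mul_galois hm4 hsq hd'
  have hdq : θ ^ 2 = algebraMap ℚ (CyclotomicField M ℚ) ((4 * m : ℤ) : ℚ) := by
    rw [hθ2, map_intCast]
  have hθ0 : θ ≠ 0 := fun h0 => by
    rw [h0, zero_pow two_ne_zero, eq_comm, Int.cast_eq_zero] at hθ2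
    exact mul_ne_zero four_ne_zero hsq.ne_zero hθ2
  have hθnot := not_mem_range_of_kronecker_galois hm4 hsq hd' hθ0 hθσ
  exact finite_chiPart_of_finite_quadraticTwist W hθnot hdq
    (fun σ => jacobiSym_autEquivPow_eq_one_or_of_natAbs_dvd (dvd_trans (dvd_mul_left _ 4) hd') σ)
    hθσ (coe_cyclotomicCharacterOf_changeLevel_of_forall_odd hq hd hχ) hfin

/-! ## 7. Both parities: the Kronecker character of any quadratic field `K ⊂ ℚ(ζ_M)` -/

set_option backward.isDefEq.respectTransparency false in
/-- **Kato's Cor. 14.3 (2) over `ℚ(ζ_M)` at the genus characters, from bsd.S20 for the twists.**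
Assume `kato_finite_of_L_one_ne_zero V p` for every elliptic `V/ℚ` and prime `p`. Let `E/ℚ` be
elliptic with newform `f`, `K` a quadratic field with `|d_K| ∣ M` (equivalently `K ⊂ ℚ(ζ_M)`,
conductor–discriminant formula) such that `E` has good reduction at the primes dividing `d_K`, and
`κ` the Kronecker character of `K`, i.e. the Dirichlet character mod `|d_K|` with
`κ(n) = (d_K/n)` for odd `n` (for odd `d_K` this is `(·/|d_K|)`, the tree's `jacobiChar`, by
reciprocity; for even `d_K = 4m` it is the character of `exists_dirichletCharacter_four_mul`), and
`κ̃ = changeLevel κ` mod `M`. If the mod-`M` series `∑ κ̃(n) aₙ n⁻ˢ` has an entire continuation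
non-vanishing at `1`, then `E(ℚ(ζ_M))^(κ̃)` is finite. By the classification of fundamental
discriminants (`isFundamentalDiscriminant_discr`) this is
`kato_finite_chiPart_changeLevel_jacobiChar_of_kato_finite_of_L_one_ne_zero` (odd `d_K`, file
`KatoTwistedFinitenessQuadraticTwistProofs`) or
`kato_finite_chiPart_changeLevel_kronecker_of_kato_finite_of_L_one_ne_zero` (even `d_K`). Thus the
statement of `kato_finite_chiPart_of_twistedLValue_ne_zero` holds, modulo its own `K = ℚ` case
bsd.S20, at every real-valued Dirichlet character whose conductor is prime to the conductor of `E`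
(the trivial character being `KatoTwistedFinitenessTrivialCharacterProofs`).
[cite: Kato2004Asterisque, Cor. 14.3 (2) (p. 235)] -/
theorem kato_finite_chiPart_changeLevel_kroneckerChar_of_kato_finite_of_L_one_ne_zero
    (hS20 : ∀ (V : WeierstrassCurve ℚ) [V.IsElliptic] (p : ℕ) [Fact p.Prime],
      kato_finite_of_L_one_ne_zero V p)
    (W : WeierstrassCurve ℚ) [W.IsElliptic] {N : ℕ} [NeZero N] {f : CuspForm (Gamma0 N) 2}
    (hf : IsNewformOf W f) [DecidableEq (CyclotomicField M ℚ)]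
    (K : Type) [Field K] [NumberField K] (h2 : Module.finrank ℚ K = 2)
    (hd : (NumberField.discr K).natAbs ∣ M) {κ : DirichletCharacter ℂ (NumberField.discr K).natAbs}
    (hκ : ∀ n : ℕ, Odd n → κ n = (J(NumberField.discr K | n) : ℂ))
    (hgood : ∀ v : HeightOneSpectrum (𝓞 ℚ), ((primesEquiv v : ℕ) : ℤ) ∣ NumberField.discr K →
      W.HasGoodReductionAt v)
    (hL : ∃ L : ℂ → ℂ, Differentiable ℂ L ∧
      (∀ s : ℂ, 2 < s.re →
        L s = twistedLSeries f (DirichletCharacter.changeLevel hd κ) s) ∧ L 1 ≠ 0) :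
    Finite (chiPart
      (fun σ : CyclotomicField M ℚ ≃ₐ[ℚ] CyclotomicField M ℚ =>
        Point.map (W' := W.toAffine) (σ : CyclotomicField M ℚ →ₐ[ℚ] CyclotomicField M ℚ))
      (fun σ => (cyclotomicCharacterOf (DirichletCharacter.changeLevel hd κ) σ : ℂ))) := by
  haveI : NeZero (NumberField.discr K).natAbs :=
    ⟨Int.natAbs_ne_zero.mpr (NumberField.discr_ne_zero K)⟩
  rcases isFundamentalDiscriminant_discr (K := K) h2 with ⟨h1, hsqD, hne1⟩ | ⟨h4, hm4, hsq⟩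
  · -- odd discriminant: `κ = (·/|d_K|)`
    have hodd : Odd (NumberField.discr K).natAbs := by
      rw [Int.natAbs_odd]
      exact Int.odd_iff.mpr (by omega)
    have hsq' : Squarefree (NumberField.discr K).natAbs := Int.squarefree_natAbs.mpr hsqD
    have hne1' : (NumberField.discr K).natAbs ≠ 1 := by
      intro h
      rcases Int.natAbs_eq (NumberField.discr K) with hD | hD <;> rw [h] at hD <;> omega
    have hκeq : κ = jacobiChar (NumberField.discr K).natAbs := by
      refine MulChar.ext fun u => ?_
      obtain ⟨r, hr, hru⟩ : ∃ r : ℕ, Odd r ∧ (r : ZMod (NumberField.discr K).natAbs) = u := by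
        by_cases hpar : Odd (u : ZMod (NumberField.discr K).natAbs).val
        · exact ⟨_, hpar, ZMod.natCast_zmod_val _⟩
        · refine ⟨(u : ZMod (NumberField.discr K).natAbs).val + (NumberField.discr K).natAbs,
            (Nat.not_odd_iff_even.mp hpar).add_odd hodd, ?_⟩
          rw [Nat.cast_add, ZMod.natCast_self, add_zero, ZMod.natCast_zmod_val]
      rw [← hru, hκ r hr, jacobiChar_natCast, jacobiSym_natAbs_eq_of_emod_four_eq_one h1 hr]
    subst hκeq
    exact kato_finite_chiPart_changeLevel_jacobiChar_of_kato_finite_of_L_one_ne_zero hS20 W hf hd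
      hodd hsq' hne1' (fun v hv => hgood v (Int.natCast_dvd.mpr hv)) hL
  · -- even discriminant `d_K = 4m`
    obtain ⟨m, hDm⟩ := h4
    have hdiv : NumberField.discr K / 4 = m := by rw [hDm, Int.mul_ediv_cancel_left _ four_ne_zero]
    rw [hdiv] at hm4 hsq
    have hq : (NumberField.discr K).natAbs = 4 * m.natAbs := by rw [hDm, Int.natAbs_mul]; rfl
    have hκ' : ∀ n : ℕ, Odd n → κ n = (J(m | n) : ℂ) := fun n hn => by
      rw [hκ n hn, hDm, jacobiSym.mul_left, jacobiSym_four_of_odd hn, one_mul]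
    have hgood' : ∀ v : HeightOneSpectrum (𝓞 ℚ), ((primesEquiv v : ℕ) : ℤ) ∣ 4 * m →
        W.HasGoodReductionAt v := fun v hv => hgood v (by rwa [hDm])
    exact kato_finite_chiPart_changeLevel_kronecker_of_kato_finite_of_L_one_ne_zero hS20 W hf hm4
      hsq hq hd hκ' hgood' hL

set_option backward.isDefEq.respectTransparency false in
/-- **The least-modulus case `M = |d_K|`** of
`kato_finite_chiPart_changeLevel_kroneckerChar_of_kato_finite_of_L_one_ne_zero`: Kato's
Cor. 14.3 (2) over the genus field `ℚ(ζ_{|d_K|})` at the Kronecker character `κ` of the quadratic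
field `K` itself (no inflation), from bsd.S20 for the twist `E^{(d_K)}`.
[cite: Kato2004Asterisque, Cor. 14.3 (2) (p. 235)] -/
theorem kato_finite_chiPart_kroneckerChar_of_kato_finite_of_L_one_ne_zero
    (hS20 : ∀ (V : WeierstrassCurve ℚ) [V.IsElliptic] (p : ℕ) [Fact p.Prime],
      kato_finite_of_L_one_ne_zero V p)
    (W : WeierstrassCurve ℚ) [W.IsElliptic] {N : ℕ} [NeZero N] {f : CuspForm (Gamma0 N) 2}
    (hf : IsNewformOf W f) (K : Type) [Field K] [NumberField K] (h2 : Module.finrank ℚ K = 2)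
    [NeZero (NumberField.discr K).natAbs]
    [DecidableEq (CyclotomicField (NumberField.discr K).natAbs ℚ)]
    {κ : DirichletCharacter ℂ (NumberField.discr K).natAbs}
    (hκ : ∀ n : ℕ, Odd n → κ n = (J(NumberField.discr K | n) : ℂ))
    (hgood : ∀ v : HeightOneSpectrum (𝓞 ℚ), ((primesEquiv v : ℕ) : ℤ) ∣ NumberField.discr K →
      W.HasGoodReductionAt v)
    (hL : ∃ L : ℂ → ℂ, Differentiable ℂ L ∧
      (∀ s : ℂ, 2 < s.re → L s = twistedLSeries f κ s) ∧ L 1 ≠ 0) :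
    Finite (chiPart
      (fun σ : CyclotomicField (NumberField.discr K).natAbs ℚ ≃ₐ[ℚ]
          CyclotomicField (NumberField.discr K).natAbs ℚ =>
        Point.map (W' := W.toAffine) (σ : CyclotomicField (NumberField.discr K).natAbs ℚ →ₐ[ℚ]
          CyclotomicField (NumberField.discr K).natAbs ℚ))
      (fun σ => (cyclotomicCharacterOf κ σ : ℂ))) := by
  have h := kato_finite_chiPart_changeLevel_kroneckerChar_of_kato_finite_of_L_one_ne_zero hS20 W hf
    K h2 (dvd_refl _) hκ hgood (by rwa [DirichletCharacter.changeLevel_self])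
  rwa [DirichletCharacter.changeLevel_self] at h

end Assembly

end Literature.NumberTheory.EllipticCurves

end
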